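import Summits.QuantumFields.GaugeBoot.TiltedRPCut
import Literature.MathematicalPhysics.QuantumFieldTheory.LatticeSiteRPMechanism
import HarnessLib

/-!
# Diagonal reflection positivity of the Wilson measure of a periodic lattice with a tilted frame
(gauge-boot, L3(σ) part 5)

HONEST FRAMING (cell `pub-gaugeboot`, page 1 of every file): the venture produces certified bounds
on lattice expectations at stated coupling, gauge group, dimension and torus size; NOT a mass gap,
NOT a continuum limit, NOT a string tension; NOT Yang–Mills-summit-bearing (barriers
`FixedCouplingUltralocality`, `PerturbativeInvisibility`).

**Theorem (`integral_conj_mul_nonneg`).** Let `(A, e)` be a periodic lattice (finite additive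
commutative site group, marked translations `e : Fin d → A`) carrying a tilted diagonal frame
`IsTiltedFrame e i j θ P v` (`TiltedRPGeometry.lean`: mirror `θ` exchanging `e i` and `e j`, height
`v : A →+ ZMod (2P)`, `P ≥ 2`, both layers `v = 0`, `v = P` pointwise `θ`-fixed). Let `G` be a compact
second countable group, `ρ` a continuous matrix representation and `β ≥ 0`. Then the Wilson
probability measure `μ_β = Z⁻¹ e^{-β S} ∏ dU` (`gibbs ρ e β`, `TiltedLatticeGauge.lean`) is
REFLECTION POSITIVE for the mirror `Θ = configSwap i j θ`:
`0 ≤ ∫ conj F(ΘU) · F(U) dμ_β(U)` for every bounded measurable `F` depending only on the links of the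
closed half `{0 ≤ v ≤ P}` (`IsHalfObservable`). Corollary (`sum_mul_conj_integral_nonneg`): the
diagonal RP blocks `(∫ conj(F_a ∘ Θ) F_b dμ_β)_{a,b}` are positive semidefinite. Also: the Wilson
action and the Wilson measure are `Θ`-invariant (`wilsonAction_configSwap`,
`integral_comp_configSwap_gibbs`).

**Proof** — Osterwalder–Seiler 1978 §2 / Fröhlich–Israel–Lieb–Simon 1978 Thm. 2.1 (reflection in
lattice hyperplanes through sites), in the form of the tree's abstract mechanism with a shared
block `LatticeRP.integral_mul_conj_mul_exp_nonneg_of_shared`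
(`Literature/MathematicalPhysics/QuantumFieldTheory/LatticeSiteRPMechanism.lean`): index set = the
links, product Haar measure, `Θ` = the measure-preserving relabelling `configSwap`, shared block
`M` = the mirror links (inside the two layers, fixed by the swap), positive block `P` = the other
links of the closed half (carried out of the closed half by the swap), no crossing links; by
`TiltedRPCut.lean`, `e^{β ∑_p Re tr ρ(U_p)} conj F(ΘU) F(U) = g(U) conj g(ΘU) exp(∑_ι a_ι(U) conj a_ι(ΘU))`
with `g = F e^{β(A + M/2)}` and the cut-plaquette Gram coefficients `a_ι`, all functions of the
positive and mirror links.

This is the positive counterpart, for FILS's 45°-tilted periodic boxes (instance in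
`TiltedBox.lean`), of the torus negatives `DiagonalRPTorusNegative.lean` ff.: what fails on the
cubic torus is exactly the axiom `fix_of_layer` (the back layer of `(ℤ/L)^d` is not pointwise fixed).

References: K. Osterwalder, E. Seiler, Ann. Phys. 110 (1978) 440, §2; J. Fröhlich, R. Israel,
E. H. Lieb, B. Simon, Comm. Math. Phys. 62 (1978) 1, Thm. 2.1, and J. Stat. Phys. 22 (1980) 297, §3
(Model 3.1: "one takes a periodic box with sides at 45°"); V. Kazakov, Z. Zheng, arXiv:2203.11360
§2, arXiv:2404.16925 §3.2 (the diagonal RP family of the bootstrap).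
-/

noncomputable section

open MeasureTheory Complex
open scoped ComplexOrder ComplexConjugate
open Literature.MathematicalPhysics.QuantumFieldTheory (haarProbability LatticeRP.splice
  LatticeRP.splice_eq_piecewise LatticeRP.integral_mul_conj_mul_exp_nonneg_of_shared)
open Literature.RepresentationTheory.CompactGroups

namespace Summit.QuantumFields.GaugeBoot

namespace TiltedRP

namespace IsTiltedFrame

variable {A : Type*} [AddCommGroup A] [Fintype A] {d : ℕ}
variable {e : Fin d → A} {i j : Fin d} {θ : A →+ A} {P : ℕ} {v : A →+ ZMod (2 * P)}
variable (hF : IsTiltedFrame e i j θ P v)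
variable {N : ℕ} {G : Type*} [Group G] [TopologicalSpace G] [IsTopologicalGroup G] [CompactSpace G]
  [MeasurableSpace G] [BorelSpace G] [SecondCountableTopology G]
variable (ρ : G →* Matrix (Fin N) (Fin N) ℂ)
include hF

/-! ## The blocks of links and the swap as a measure-preserving relabelling -/

open scoped Classical in
omit hF in
/-- The positive links (block `P` of the mechanism). -/
def posBlock (e : Fin d → A) (i j : Fin d) (v : A →+ ZMod (2 * P)) : Finset (Link A d) :=
  Finset.univ.filter fun l => IsPosLink e i j P v l

open scoped Classical in
omit hF in
/-- The mirror links (shared block `M` of the mechanism). -/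
def mirrorBlock (i j : Fin d) (v : A →+ ZMod (2 * P)) : Finset (Link A d) :=
  Finset.univ.filter fun l => IsMirrorLink i j P v l

omit hF in
/-- Membership in the positive block. -/
theorem mem_posBlock {l : Link A d} : l ∈ posBlock e i j v ↔ IsPosLink e i j P v l := by
  classical
  simp [posBlock]

omit hF in
/-- Membership in the mirror block. -/
theorem mem_mirrorBlock {l : Link A d} : l ∈ mirrorBlock i j v ↔ IsMirrorLink i j P v l := by
  classical
  simp [mirrorBlock]

omit hF in
/-- The mirror and positive blocks are disjoint. -/
theorem disjoint_mirrorBlock_posBlock : Disjoint (mirrorBlock i j v) (posBlock e i j v) :=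
  Finset.disjoint_left.2 fun _ hm hp => (mem_posBlock.1 hp).2 (mem_mirrorBlock.1 hm)

omit [Group G] [TopologicalSpace G] [IsTopologicalGroup G] [CompactSpace G] [MeasurableSpace G]
  [BorelSpace G] [SecondCountableTopology G] hF in
/-- Two configurations agreeing on the positive and mirror links agree on the closed half. -/
theorem eq_on_half_of_eq_on_blocks [DecidableEq A] {U V : Config A d G}
    (hF' : IsTiltedFrame e i j θ P v)
    (h : ∀ l ∈ ((posBlock e i j v ∪ ∅ ∪ mirrorBlock i j v : Finset (Link A d)) : Set (Link A d)),
      U l = V l) : ∀ l, IsHalfLink e P v l → U l = V l := by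
  intro l hl
  apply h
  rw [Finset.union_empty, Finset.coe_union, Set.mem_union, Finset.mem_coe, Finset.mem_coe,
    mem_posBlock, mem_mirrorBlock]
  exact (hF'.isHalfLink_iff_pos_or_mirror l).1 hl

/-- The swap of links as a permutation. -/
def linkPerm (hF : IsTiltedFrame e i j θ P v) : Equiv.Perm (Link A d) :=
  Function.Involutive.toPerm (linkSwap i j θ) hF.linkSwap_involutive

omit [Fintype A] [Group G] [TopologicalSpace G] [IsTopologicalGroup G] [CompactSpace G] [BorelSpace G]
  [SecondCountableTopology G] in
/-- `configSwap` is precomposition with `linkPerm`. -/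
theorem configSwap_eq_arrowCongr :
    (configSwap (G := G) i j θ : Config A d G → Config A d G) =
      ⇑(MeasurableEquiv.arrowCongr' hF.linkPerm (MeasurableEquiv.refl G)) := by
  funext U l; rfl

/-- **The swap preserves the product Haar measure** (a relabelling of the factors). -/
theorem measurePreserving_configSwap :
    MeasurePreserving (configSwap (G := G) i j θ) (productHaar A d G) (productHaar A d G) := by
  haveI : IsProbabilityMeasure (haarProbability G) :=
    CompactGroup.isProbabilityMeasure_haarMeasure_top
  have h := measurePreserving_arrowCongr' (fun _ : Link A d => haarProbability G)
    (fun _ : Link A d => haarProbability G) hF.linkPerm (MeasurableEquiv.refl G)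
    fun _ => MeasurePreserving.id _
  rw [hF.configSwap_eq_arrowCongr]
  exact h

omit [Fintype A] [Group G] [TopologicalSpace G] [IsTopologicalGroup G] [CompactSpace G] [BorelSpace G]
  [SecondCountableTopology G] hF in
/-- The swap of configurations is measurable. -/
theorem measurable_configSwap : Measurable (configSwap (G := G) i j θ) :=
  measurable_pi_lambda _ fun _ => measurable_pi_apply _

omit [Group G] [TopologicalSpace G] [IsTopologicalGroup G] [CompactSpace G] [MeasurableSpace G]
  [BorelSpace G] [SecondCountableTopology G] in
/-- The swap fixes the mirror links. -/
theorem configSwap_apply_of_mem_mirrorBlock (U : Config A d G) (l : Link A d)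
    (hl : l ∈ mirrorBlock i j v) : configSwap i j θ U l = U l := by
  rw [configSwap_apply, hF.linkSwap_of_isMirrorLink (mem_mirrorBlock.1 hl)]

omit [Group G] [TopologicalSpace G] [IsTopologicalGroup G] [CompactSpace G] [MeasurableSpace G]
  [BorelSpace G] [SecondCountableTopology G] in
/-- The swapped value of a positive link is read off a link outside the positive block. -/
theorem dependsOn_configSwap_apply [DecidableEq A] (l : Link A d) (hl : l ∈ posBlock e i j v ∪ ∅) :
    DependsOn (fun U : Config A d G => configSwap i j θ U l)
      (((posBlock e i j v)ᶜ : Finset (Link A d)) : Set (Link A d)) := by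
  intro U V h
  rw [Finset.union_empty] at hl
  refine h (linkSwap i j θ l) ?_
  rw [Finset.coe_compl, Set.mem_compl_iff, Finset.mem_coe, mem_posBlock]
  exact fun hp => hF.not_isHalfLink_linkSwap (mem_posBlock.1 hl) hp.1

/-! ## The observable `g` and the pointwise identity -/

open scoped Classical in
omit hF in
/-- The observable `g = F · exp(β (A + M/2))` (`A`, `M` = positive and mirror parts of `∑ Re tr`). -/
def gObs (e : Fin d → A) (i j : Fin d) (v : A →+ ZMod (2 * P)) (β : ℝ) (F : Config A d G → ℂ)
    (U : Config A d G) : ℂ :=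
  F U * (Real.exp (β * (∑ p ∈ Finset.univ.filter (IsPosPlaq i j P v), plaqObs ρ e p U +
    (∑ p ∈ Finset.univ.filter (IsMirrorPlaq i j P v), plaqObs ρ e p U) / 2)) : ℂ)

open scoped Classical in
omit [MeasurableSpace G] [BorelSpace G] [SecondCountableTopology G] in
/-- **The pointwise identity**:
`e^{β ∑_p Re tr ρ(U_p)} conj F(ΘU) F(U) = g(U) conj g(ΘU) · exp(∑_ι a_ι(U) conj a_ι(ΘU))`. -/
theorem weight_mul_eq (hρ : Continuous ρ) {β : ℝ} (hβ : 0 ≤ β) (F : Config A d G → ℂ)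
    (U : Config A d G) :
    (Real.exp (β * ∑ p, plaqObs ρ e p U) : ℂ) * (conj (F (configSwap i j θ U)) * F U) =
      gObs ρ e i j v β F U * conj (gObs ρ e i j v β F (configSwap i j θ U)) *
        Complex.exp (∑ ι, coeff ρ e i j v hρ β ι U *
          conj (coeff ρ e i j v hρ β ι (configSwap i j θ U))) := by
  rw [hF.sum_coeff_mul_conj ρ hρ hβ, gObs, gObs, hF.sum_mirror_configSwap ρ hρ,
    hF.sum_plaqObs_split ρ hρ, ← Complex.ofReal_exp]
  set A1 := ∑ p ∈ Finset.univ.filter (IsPosPlaq i j P v), plaqObs ρ e p U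
  set A2 := ∑ p ∈ Finset.univ.filter (IsPosPlaq i j P v), plaqObs ρ e p (configSwap i j θ U)
  set M1 := ∑ p ∈ Finset.univ.filter (IsMirrorPlaq i j P v), plaqObs ρ e p U
  set C1 := ∑ p ∈ Finset.univ.filter (IsCutPlaq i j P v), plaqObs ρ e p U
  simp only [map_mul, Complex.conj_ofReal]
  rw [show β * (A1 + A2 + M1 + C1) = β * (A1 + M1 / 2) + β * (A2 + M1 / 2) + β * C1 by ring,
    Real.exp_add, Real.exp_add]
  push_cast
  ring

open scoped Classical in
omit [CompactSpace G] hF in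
/-- The observable `g` is measurable. -/
theorem measurable_gObs (hρ : Continuous ρ) (β : ℝ) {F : Config A d G → ℂ} (hFm : Measurable F) :
    Measurable (gObs ρ e i j v β F) := by
  unfold gObs
  refine hFm.mul (Complex.measurable_ofReal.comp (Measurable.exp (Measurable.const_mul ?_ β)))
  exact ((continuous_finsetSum _ fun p _ => continuous_plaqObs ρ hρ e p).measurable).add
    (((continuous_finsetSum _ fun p _ => continuous_plaqObs ρ hρ e p).measurable).div_const _)

open scoped Classical in
omit [MeasurableSpace G] [BorelSpace G] [SecondCountableTopology G] hF in
/-- The observable `g` is bounded. -/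
theorem norm_gObs_le (hρ : Continuous ρ) {β : ℝ} (hβ : 0 ≤ β) {F : Config A d G → ℂ} {CF : ℝ}
    (hFb : ∀ U, ‖F U‖ ≤ CF) (U : Config A d G) :
    ‖gObs ρ e i j v β F U‖ ≤ |CF| * Real.exp (β * (2 * (N * Fintype.card (Plaq A d)))) := by
  rw [gObs, norm_mul, Complex.norm_real, Real.norm_eq_abs, abs_of_pos (Real.exp_pos _)]
  refine mul_le_mul ((hFb _).trans (le_abs_self _)) ?_ (Real.exp_pos _).le (abs_nonneg _)
  refine Real.exp_le_exp.2 (mul_le_mul_of_nonneg_left ?_ hβ)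
  have h1 := abs_sum_plaqObs_le ρ hρ e (Finset.univ.filter (IsPosPlaq i j P v)) U
  have h2 := abs_sum_plaqObs_le ρ hρ e (Finset.univ.filter (IsMirrorPlaq i j P v)) U
  have c1 : ((Finset.univ.filter (IsPosPlaq i j P v)).card : ℝ) ≤ Fintype.card (Plaq A d) := by
    exact_mod_cast Finset.card_filter_le _ _
  have c2 : ((Finset.univ.filter (IsMirrorPlaq i j P v)).card : ℝ) ≤ Fintype.card (Plaq A d) := by
    exact_mod_cast Finset.card_filter_le _ _
  have hN : (0 : ℝ) ≤ N := Nat.cast_nonneg _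
  rw [abs_le] at h1 h2
  nlinarith

open scoped Classical in
omit [TopologicalSpace G] [IsTopologicalGroup G] [CompactSpace G] [MeasurableSpace G] [BorelSpace G]
  [SecondCountableTopology G] in
/-- The observable `g` depends only on the positive and mirror links. -/
theorem dependsOn_gObs [DecidableEq A] (β : ℝ) {F : Config A d G → ℂ} (hFo : IsHalfObservable e P v F) :
    DependsOn (gObs ρ e i j v β F)
      ((posBlock e i j v ∪ ∅ ∪ mirrorBlock i j v : Finset (Link A d)) : Set (Link A d)) := by
  intro U V h
  have hUV := eq_on_half_of_eq_on_blocks hF h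
  have hA : ∑ p ∈ Finset.univ.filter (IsPosPlaq i j P v), plaqObs ρ e p U =
      ∑ p ∈ Finset.univ.filter (IsPosPlaq i j P v), plaqObs ρ e p V :=
    Finset.sum_congr rfl fun p hp => by
      obtain ⟨h1, h2, h3, h4⟩ := hF.isHalfLink_of_isPosPlaq (Finset.mem_filter.1 hp).2
      exact plaqObs_congr ρ p (hUV _ h1) (hUV _ h2) (hUV _ h3) (hUV _ h4)
  have hM : ∑ p ∈ Finset.univ.filter (IsMirrorPlaq i j P v), plaqObs ρ e p U =
      ∑ p ∈ Finset.univ.filter (IsMirrorPlaq i j P v), plaqObs ρ e p V :=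
    Finset.sum_congr rfl fun p hp => by
      obtain ⟨h1, h2, h3, h4⟩ := hF.isHalfLink_of_isMirrorPlaq (Finset.mem_filter.1 hp).2
      exact plaqObs_congr ρ p (hUV _ h1) (hUV _ h2) (hUV _ h3) (hUV _ h4)
  simp only [gObs, hFo U V hUV, hA, hM]

open scoped Classical in
omit [MeasurableSpace G] [BorelSpace G] [SecondCountableTopology G] in
/-- The coefficient functions depend only on the positive and mirror links. -/
theorem dependsOn_coeff [DecidableEq A] (hρ : Continuous ρ) (β : ℝ) (ι : Plaq A d × Fin N × Fin N × Bool) :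
    DependsOn (coeff ρ e i j v hρ β ι : Config A d G → ℂ)
      ((posBlock e i j v ∪ ∅ ∪ mirrorBlock i j v : Finset (Link A d)) : Set (Link A d)) :=
  fun _ _ h => hF.coeff_congr ρ hρ β ι (eq_on_half_of_eq_on_blocks hF h)

/-! ## Reflection positivity -/

open scoped Classical in
/-- **Reflection positivity of the plaquette weight**: for `β ≥ 0` and `F` bounded measurable
depending on the closed half, `0 ≤ ∫ e^{β ∑_p Re tr ρ(U_p)} conj F(ΘU) F(U) ∏ dU`. -/
theorem integral_exp_sum_mul_nonneg (hρ : Continuous ρ) {β : ℝ} (hβ : 0 ≤ β)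
    {F : Config A d G → ℂ} (hFm : Measurable F) {CF : ℝ} (hFb : ∀ U, ‖F U‖ ≤ CF)
    (hFo : IsHalfObservable e P v F) :
    0 ≤ ∫ U, (Real.exp (β * ∑ p, plaqObs ρ e p U) : ℂ) * (conj (F (configSwap i j θ U)) * F U)
      ∂(productHaar A d G) := by
  classical
  haveI : IsProbabilityMeasure (haarProbability G) :=
    CompactGroup.isProbabilityMeasure_haarMeasure_top
  simp_rw [hF.weight_mul_eq ρ hρ hβ F]
  have h := LatticeRP.integral_mul_conj_mul_exp_nonneg_of_shared (haarProbability G)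
    (mirrorBlock i j v) (posBlock e i j v) ∅ (configSwap i j θ) hF.measurePreserving_configSwap
    (fun U l hl => hF.configSwap_apply_of_mem_mirrorBlock U l hl)
    (fun l hl => hF.dependsOn_configSwap_apply l hl) disjoint_mirrorBlock_posBlock
    (Finset.disjoint_empty_right _) (g := gObs ρ e i j v β F)
    (a := fun ι U => coeff ρ e i j v hρ β ι U)
    (measurable_gObs ρ hρ β hFm) (fun ι => measurable_coeff ρ hρ β ι)
    (norm_gObs_le ρ hρ hβ hFb) (fun ι U => norm_coeff_le ρ hρ β ι U)
    (hF.dependsOn_gObs ρ β hFo) (fun ι => hF.dependsOn_coeff ρ hρ β ι)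
  simp only [LatticeRP.splice_eq_piecewise, Finset.piecewise_empty] at h
  unfold productHaar
  rwa [integral_fun_fst (fun U : Config A d G => gObs ρ e i j v β F U *
      conj (gObs ρ e i j v β F (configSwap i j θ U)) *
      Complex.exp (∑ ι, coeff ρ e i j v hρ β ι U * conj (coeff ρ e i j v hρ β ι (configSwap i j θ U)))),
    probReal_univ, one_smul] at h

/-- **Reflection positivity of the Boltzmann weight**:
`0 ≤ ∫ e^{-β S(U)} conj F(ΘU) F(U) ∏ dU` (`e^{-β S} = e^{-β N #P} e^{β ∑ Re tr}`). -/
theorem integral_boltzmann_mul_nonneg (hρ : Continuous ρ) {β : ℝ} (hβ : 0 ≤ β)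
    {F : Config A d G → ℂ} (hFm : Measurable F) {CF : ℝ} (hFb : ∀ U, ‖F U‖ ≤ CF)
    (hFo : IsHalfObservable e P v F) :
    0 ≤ ∫ U, (Real.exp (-β * wilsonAction ρ e U) : ℂ) * (conj (F (configSwap i j θ U)) * F U)
      ∂(productHaar A d G) := by
  have hsplit : ∀ U : Config A d G, (Real.exp (-β * wilsonAction ρ e U) : ℂ) =
      (Real.exp (-β * (N * Fintype.card (Plaq A d))) : ℂ) *
        (Real.exp (β * ∑ p, plaqObs ρ e p U) : ℂ) := fun U => by
    rw [← Complex.ofReal_mul, ← Real.exp_add, wilsonAction_eq]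
    congr 2
    ring
  simp_rw [hsplit, mul_assoc]
  rw [integral_const_mul]
  exact mul_nonneg (Complex.zero_le_real.2 (Real.exp_pos _).le)
    (hF.integral_exp_sum_mul_nonneg ρ hρ hβ hFm hFb hFo)

/-- **Diagonal reflection positivity of the Wilson measure of a periodic lattice with a tilted
frame** (Osterwalder–Seiler 1978 §2; Fröhlich–Israel–Lieb–Simon 1978 Thm. 2.1 / 1980 §3): for a
compact second countable `G`, continuous `ρ`, `β ≥ 0` and every bounded measurable observable `F` of
the closed half `{0 ≤ v ≤ P}`, `0 ≤ ∫ conj F(ΘU) F(U) dμ_β(U)`. -/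
theorem integral_conj_mul_nonneg (hρ : Continuous ρ) {β : ℝ} (hβ : 0 ≤ β)
    (F : Config A d G → ℂ) (hFm : Measurable F) (hFb : ∃ C : ℝ, ∀ U, ‖F U‖ ≤ C)
    (hFo : IsHalfObservable e P v F) :
    0 ≤ ∫ U, conj (F (configSwap i j θ U)) * F U ∂(gibbs ρ e β) := by
  obtain ⟨CF, hFb⟩ := hFb
  have hZ := normaliser_pos (A := A) (G := G) ρ hρ e β
  rw [integral_gibbs]
  simp_rw [Complex.real_smul, Complex.ofReal_div, div_eq_mul_inv, mul_comm (Complex.ofReal _)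
    ((_ : ℂ)⁻¹), mul_assoc]
  rw [integral_const_mul]
  refine mul_nonneg ?_ (hF.integral_boltzmann_mul_nonneg ρ hρ hβ hFm hFb hFo)
  rw [← Complex.ofReal_inv]
  exact Complex.zero_le_real.2 (inv_nonneg.2 hZ.le)

/-- **The diagonal RP blocks are positive semidefinite**: for bounded measurable half-space
observables `F_1, …, F_n` and `c ∈ ℂ^n`, `0 ≤ ∑_{a,b} conj c_a · c_b · ∫ conj(F_a(ΘU)) F_b(U) dμ_β` —
the finite-volume justification of the bootstrap's diagonal positivity matrices on a tilted box. -/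
theorem sum_mul_conj_integral_nonneg (hρ : Continuous ρ) {β : ℝ} (hβ : 0 ≤ β) {n : ℕ}
    (F : Fin n → Config A d G → ℂ) (hFm : ∀ a, Measurable (F a))
    (hFb : ∀ a, ∃ C : ℝ, ∀ U, ‖F a U‖ ≤ C) (hFo : ∀ a, IsHalfObservable e P v (F a)) (c : Fin n → ℂ) :
    0 ≤ ∑ a, ∑ b, conj (c a) * c b *
      ∫ U, conj (F a (configSwap i j θ U)) * F b U ∂(gibbs ρ e β) := by
  haveI := isProbabilityMeasure_gibbs (A := A) (G := G) ρ hρ e β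
  -- the combination `H = ∑_b c_b F_b`
  set H : Config A d G → ℂ := fun U => ∑ b, c b * F b U with hH
  have hHm : Measurable H := Finset.measurable_sum _ fun b _ => (hFm b).const_mul _
  choose C hC using hFb
  have hHb : ∃ K : ℝ, ∀ U, ‖H U‖ ≤ K := ⟨∑ b, ‖c b‖ * C b, fun U =>
    (norm_sum_le _ _).trans (Finset.sum_le_sum fun b _ => by
      rw [norm_mul]; exact mul_le_mul_of_nonneg_left (hC b U) (norm_nonneg _))⟩
  have hHo : IsHalfObservable e P v H := fun U V hUV => by
    simp only [hH]
    exact Finset.sum_congr rfl fun b _ => by rw [hFo b U V hUV]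
  have key := hF.integral_conj_mul_nonneg ρ hρ hβ H hHm hHb hHo
  -- expand `∫ conj H(ΘU) H(U)` by linearity
  have hint : ∀ a b, Integrable (fun U => conj (F a (configSwap i j θ U)) * F b U) (gibbs ρ e β) :=
    fun a b => Integrable.of_bound
      (((Complex.continuous_conj.measurable.comp ((hFm a).comp measurable_configSwap)).mul
        (hFm b)).aestronglyMeasurable) (C a * C b) (ae_of_all _ fun U => by
        rw [norm_mul, Complex.norm_conj]
        exact mul_le_mul (hC a _) (hC b U) (norm_nonneg _) ((norm_nonneg (F a U)).trans (hC a U)))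
  have hexp : ∫ U, conj (H (configSwap i j θ U)) * H U ∂(gibbs ρ e β) =
      ∑ a, ∑ b, conj (c a) * c b * ∫ U, conj (F a (configSwap i j θ U)) * F b U ∂(gibbs ρ e β) := by
    have h1 : ∀ U, conj (H (configSwap i j θ U)) * H U =
        ∑ a, ∑ b, conj (c a) * c b * (conj (F a (configSwap i j θ U)) * F b U) := fun U => by
      simp only [hH, map_sum, map_mul]
      rw [Finset.sum_mul_sum]
      exact Finset.sum_congr rfl fun a _ => Finset.sum_congr rfl fun b _ => by ring
    simp_rw [h1]
    rw [integral_finsetSum _ fun a _ => integrable_finsetSum _ fun b _ => (hint a b).const_mul _]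
    refine Finset.sum_congr rfl fun a _ => ?_
    rw [integral_finsetSum _ fun b _ => (hint a b).const_mul _]
    exact Finset.sum_congr rfl fun b _ => integral_const_mul _ _
  rwa [hexp] at key

/-! ## Swap invariance of the action and of the Wilson measure -/

omit [MeasurableSpace G] [BorelSpace G] [SecondCountableTopology G] in
/-- **The Wilson action is swap invariant**: `S(ΘU) = S(U)`. -/
theorem wilsonAction_configSwap (hρ : Continuous ρ) (U : Config A d G) :
    wilsonAction ρ e (configSwap i j θ U) = wilsonAction ρ e U := by
  rw [wilsonAction_eq, wilsonAction_eq]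
  congr 1
  exact Fintype.sum_equiv (Function.Involutive.toPerm (plaqSwap i j θ) hF.plaqSwap_plaqSwap) _ _
    fun p => hF.plaqObs_configSwap ρ hρ p U

/-- **Swap invariance of the Wilson measure, integral form**: `∫ F(ΘU) dμ_β = ∫ F dμ_β` for every
measurable real `F` (every real `β`). -/
theorem integral_comp_configSwap_gibbs (hρ : Continuous ρ) (β : ℝ) {F : Config A d G → ℝ}
    (hFm : Measurable F) :
    ∫ U, F (configSwap i j θ U) ∂(gibbs ρ e β) = ∫ U, F U ∂(gibbs ρ e β) := by
  rw [integral_gibbs, integral_gibbs]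
  set Z := ∫ U, Real.exp (-β * wilsonAction ρ e U) ∂(productHaar A d G)
  have h1 : ∀ U : Config A d G, (Real.exp (-β * wilsonAction ρ e U) / Z) • F (configSwap i j θ U) =
      (fun V : Config A d G => (Real.exp (-β * wilsonAction ρ e V) / Z) • F V)
        (configSwap i j θ U) := by
    intro U
    simp only [hF.wilsonAction_configSwap ρ hρ]
  have hm : Measurable fun V : Config A d G => (Real.exp (-β * wilsonAction ρ e V) / Z) • F V :=
    (((continuous_boltzmann ρ hρ e β).measurable).div_const _).smul hFm
  simp_rw [h1]
  rw [← integral_map hF.measurePreserving_configSwap.measurable.aemeasurable hm.aestronglyMeasurable,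
    hF.measurePreserving_configSwap.map_eq]

end IsTiltedFrame

end TiltedRP

end Summit.QuantumFields.GaugeBoot
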